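import Summits.QuantumFields.BalabanUV.T4Continuum.Spine.NE9.MemoryFromRate

/-!
# T⁴ programme, spine estimate NE9 (node U3, history side) — BARE CONTINUITY IN THE COUPLINGS DOES NOT CLOSE NODE U3 → U6, EVEN GIVEN
# THE TOWER η-RATE: a continuous tower with exact tower rate, depending on ONE coupling of age two, whose coupling bracket against node
# U2's geometric discrepancy is `≍ 1∕m` — census item of cell `pub-balaban-gaps`, seat ne9 (gen 4), row C26 (sharpness of rows C24∕C25)

Cell `pub-balaban-gaps` (YM blitz G2, seat ne9, unit `pub-balaban-gaps-ne9-g4`; record `run/shared/lean/pub/pub-balaban-gaps/ne/NE9.md` §5 row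
C26).  Summits-side bookkeeping, companion of `MemoryFromRateModulus` (row C25: GIVEN tower-NE5, a MODULUS OF CONTINUITY in the young couplings
with summable image of node U2's profile closes node U3 → U6; Hölder ✓).  This file shows the modulus cannot be dropped: on gen 3's abstract
tower (`F m g` = the term of ONE physical localization domain in the run in which it has scale index `m`, decay stripped; node U6's socket
`T4CauchySum.delta` BY NAME) there is a tower with EVERY qualitative property the spine's shapes and the printed text offer — and a divergent
coupling bracket.

THE WITNESS (`slowTower γ`, on the window `]0, γ]` of `T4OutputRate.Window`): `F m g = φ(g_{m−2} − γ∕2)` for `m ≥ 2` (`0` below), with the SLOW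
MODULUS `φ(t) = (1 + |log|t||)⁻¹` (`φ(0) = 0`; `slowMod`).  Kernel-checked:
* `continuous_slowMod`, `continuous_slowTower`: `φ` is continuous on `ℝ` (at `0` because `|log t| → ∞`), hence every `F m` is (jointly)
  continuous in the product topology — uniformly so on the compact closure of the window;
* `slowTower_rate`: the tower rate `|F (m+1) g − F m (g ∘ succ)| ≤ θ⁻¹·θ^m` for EVERY `0 < θ` and EVERY history (exact above level 2);
* `slowTower_congr`: `F m` depends on the single coupling of age two — prefix dependence, and NO dependence on the last coupling (the only
  coupling about which print says anything: [Balaban1987RG1] p. 263 *"It is a C^∞-function of g_{j−1} ∈ [0, γ]"*);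
* `abs_sub_slowTower_eq`, `bracket_lower`: for the admissible histories `g ≡ γ∕2` and `g'_i = γ∕2 + (γ∕2)·θ′^i` (discrepancy EXACTLY node U2's
  geometric profile `(γ∕2)·θ′^i`, `0 < θ′ ≤ 1`) the bracket at level `n + 2` is `(1 + |log((γ∕2)·θ′^n)|)⁻¹ ≥ κ∕(n+1)`,
  `κ = (1 + |log(γ∕2)| + |log θ′|)⁻¹ > 0`;
* `not_summable_bracket`: so `m ↦ |F m g − F m g'|` is NOT summable (harmonic comparison), and `not_summable_delta`: NO injection dominating
  it has `Summable (T4CauchySum.delta E ρ inj)` (`E > 0`, `ρ ≥ 0`) — node U6's socket FAILS; packaged as `exists_continuousTower_not_summable`.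
VERDICT FOR THE ROW (C26): GIVEN tower-NE5, prefix dependence, independence of the last coupling, uniform bounds and CONTINUITY in every
coupling, node U3 → U6 can still fail; together with row C25 this LOCATES what NE9 must supply at its weakest — a QUANTITATIVE modulus of
continuity in the YOUNG couplings whose image of node U2's profile is summable with a first moment (Lipschitz∕Hölder ✓, `1∕|log|` ✗).  For
Bałaban's `E^{(j)}` such a modulus is exactly what only the one-step renormalization transformation as a Lean object (W1) can deliver:
print's *"C^∞ … (or analytic)"* concerns the LAST coupling only, on which the witness does not even depend.  Classification UNCHANGED
(WORK-bound on W1); the tower trick of row C24 removes the decay half and clause N2, and provably NOT the modulus.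

HONEST FRAMING: bookkeeping for rung (B)+1 on a FIXED finite four-torus; real analysis on hypothesis SHAPES (a counterexample to an
implication between shapes, not a statement about Bałaban's functionals); tower-NE5 and NE9 NOT PRINTED ∕ NOT PROVED; spine PROVED 0∕9
unchanged; NOT UV stability, NOT the continuum limit, NOT infinite volume, NOT a mass gap, NOT Clay.  HONEST DEPENDENCY: continuum YM on
T⁴ ⇐ BetaPertH ∧ nine spine estimates (0∕9 proved); BetaPertH ⇐ (D1) ∧ (D4) ∧ CAP+tail.

References (TYPES only): [Balaban1987RG1] = T. Bałaban, Commun. Math. Phys. **109** (1987) 249–301, Thm 1 p. 259, p. 263, p. 298.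
-/

namespace Summit.QuantumFields.BalabanUV.T4Continuum.NE9.MemoryFromRateSharp

open scoped BigOperators
open Finset Filter Topology
open Literature.MathematicalPhysics.QuantumFieldTheory.Balaban1983to89
open Literature.MathematicalPhysics.QuantumFieldTheory.Balaban1983to89.T4OutputRate
open T4CauchySum (delta)

/-! ## §1 The slow modulus `φ(t) = (1 + |log|t||)⁻¹`, `φ(0) = 0` -/

/-- The SLOW MODULUS `φ(t) = (1 + |log t|)⁻¹` for `t ≠ 0` (Mathlib's `Real.log t = log|t|`), `φ(0) = 0`: continuous, `0 ≤ φ ≤ 1`, and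
`φ(D·θ′^n) ≍ 1∕n` along every geometric sequence — a modulus of continuity whose image of a geometric profile is NOT summable. [folklore] -/
noncomputable def slowMod (t : ℝ) : ℝ := if t = 0 then 0 else (1 + |Real.log t|)⁻¹

/-- `φ(0) = 0`. [folklore] -/
theorem slowMod_zero : slowMod 0 = 0 := by simp [slowMod]

/-- `φ(t) = (1 + |log t|)⁻¹` off zero. [folklore] -/
theorem slowMod_of_ne_zero {t : ℝ} (ht : t ≠ 0) : slowMod t = (1 + |Real.log t|)⁻¹ := by simp [slowMod, ht]

/-- `0 ≤ φ`. [folklore] -/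
theorem slowMod_nonneg (t : ℝ) : 0 ≤ slowMod t := by
  unfold slowMod
  split_ifs
  · exact le_rfl
  · positivity

/-- `φ ≤ 1`. [folklore] -/
theorem slowMod_le_one (t : ℝ) : slowMod t ≤ 1 := by
  unfold slowMod
  split_ifs
  · exact zero_le_one
  · exact inv_le_one_of_one_le₀ (by linarith [abs_nonneg (Real.log t)])

/-- **`φ` IS CONTINUOUS ON `ℝ`** — at `t ≠ 0` as `(1 + |log t|)⁻¹`, at `0` because `log t → −∞` on the punctured neighbourhood
(`Real.tendsto_log_nhdsNE_zero`), so `(1 + |log t|)⁻¹ → 0 = φ(0)`. [folklore] -/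
theorem continuous_slowMod : Continuous slowMod := by
  rw [continuous_iff_continuousAt]
  intro t₀
  by_cases ht₀ : t₀ = 0
  · subst ht₀
    rw [← continuousWithinAt_compl_self, ContinuousWithinAt, slowMod_zero]
    have hlog : Tendsto (fun t : ℝ => 1 + |Real.log t|) (𝓝[≠] 0) atTop :=
      tendsto_atTop_add_const_left _ 1 (tendsto_abs_atBot_atTop.comp Real.tendsto_log_nhdsNE_zero)
    refine Tendsto.congr' ?_ hlog.inv_tendsto_atTop
    filter_upwards [self_mem_nhdsWithin] with t ht
    rw [Set.mem_compl_singleton_iff] at ht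
    simp only [Pi.inv_apply]
    exact (slowMod_of_ne_zero ht).symm
  · have hev : (fun t => (1 + |Real.log t|)⁻¹) =ᶠ[𝓝 t₀] slowMod := by
      filter_upwards [isOpen_ne.mem_nhds ht₀] with t ht
      exact (slowMod_of_ne_zero ht).symm
    refine ContinuousAt.congr ?_ hev
    have h1 : ContinuousAt (fun t => 1 + |Real.log t|) t₀ :=
      continuousAt_const.add (continuous_abs.continuousAt.comp (Real.continuousAt_log ht₀))
    exact h1.inv₀ (by positivity)

/-! ## §2 The slow tower on the window `]0, γ]`: continuity, age-two dependence, exact tower rate -/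

/-- The SLOW TOWER: `F m g = φ(g_{m−2} − γ∕2)` for `m ≥ 2`, `0` for `m < 2` — the scale-`m` term depends continuously on its coupling of age
two only, through the slow modulus centred at the window's midpoint. [folklore] -/
noncomputable def slowTower (γ : ℝ) (m : ℕ) (g : ℕ → ℝ) : ℝ :=
  if 2 ≤ m then slowMod (g (m - 2) - γ / 2) else 0

/-- Below level 2 the tower vanishes. [folklore] -/
theorem slowTower_of_lt {γ : ℝ} {m : ℕ} (hm : m < 2) (g : ℕ → ℝ) : slowTower γ m g = 0 := by
  simp [slowTower, not_le.mpr hm]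

/-- From level 2 on the tower is `φ(g_{m−2} − γ∕2)`. [folklore] -/
theorem slowTower_of_le {γ : ℝ} {m : ℕ} (hm : 2 ≤ m) (g : ℕ → ℝ) :
    slowTower γ m g = slowMod (g (m - 2) - γ / 2) := by
  simp [slowTower, hm]

/-- `0 ≤ F m g ≤ 1` for every history. [folklore] -/
theorem slowTower_mem_Icc (γ : ℝ) (m : ℕ) (g : ℕ → ℝ) : 0 ≤ slowTower γ m g ∧ slowTower γ m g ≤ 1 := by
  unfold slowTower
  split_ifs
  · exact ⟨slowMod_nonneg _, slowMod_le_one _⟩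
  · exact ⟨le_rfl, zero_le_one⟩

/-- **EVERY `F m` IS CONTINUOUS** (product topology on histories `ℕ → ℝ`). [folklore] -/
theorem continuous_slowTower (γ : ℝ) (m : ℕ) : Continuous (slowTower γ m) := by
  by_cases hm : 2 ≤ m
  · have e : slowTower γ m = slowMod ∘ fun g : ℕ → ℝ => g (m - 2) - γ / 2 := by
      funext g
      simp [slowTower, hm]
    rw [e]
    exact continuous_slowMod.comp ((continuous_apply (m - 2)).sub continuous_const)
  · have e : slowTower γ m = fun _ => 0 := by
      funext g
      simp [slowTower, hm]
    rw [e]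
    exact continuous_const

/-- **AGE-TWO DEPENDENCE ONLY**: `F m g` is determined by `g_{m−2}` — prefix dependence holds and the LAST coupling `g_{m−1}` (`m ≥ 2`) does
not enter at all. [folklore] -/
theorem slowTower_congr (γ : ℝ) (m : ℕ) {g g' : ℕ → ℝ} (h : g (m - 2) = g' (m - 2)) :
    slowTower γ m g = slowTower γ m g' := by
  unfold slowTower
  rw [h]

/-- **THE TOWER RATE, FOR EVERY HISTORY**: `|F (m+1) g − F m (g ∘ succ)| ≤ θ⁻¹·θ^m` for every `0 < θ` — zero at `m = 0`, at most `1 = θ⁻¹θ`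
at `m = 1`, and EXACTLY zero for `m ≥ 2` (the age-two coupling of level `m + 1` is the age-two coupling of level `m` after the shift).
[folklore] -/
theorem slowTower_rate (γ : ℝ) {θ : ℝ} (hθ : 0 < θ) (m : ℕ) (g : ℕ → ℝ) :
    |slowTower γ (m + 1) g - slowTower γ m (fun i => g (i + 1))| ≤ θ⁻¹ * θ ^ m := by
  rcases Nat.lt_or_ge m 2 with hm | hm
  · interval_cases m
    · rw [slowTower_of_lt (by norm_num), slowTower_of_lt (by norm_num), sub_self, abs_zero]
      positivity
    · rw [slowTower_of_lt (by norm_num : 1 < 2), sub_zero, pow_one, inv_mul_cancel₀ hθ.ne',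
        abs_of_nonneg (slowTower_mem_Icc γ _ g).1]
      exact (slowTower_mem_Icc γ _ g).2
  · rw [slowTower_of_le (by omega), slowTower_of_le hm, show m + 1 - 2 = m - 2 + 1 by omega, sub_self, abs_zero]
    positivity

/-! ## §3 The admissible pair with node U2's geometric discrepancy, and the harmonic bracket -/

/-- The two histories `g ≡ γ∕2` and `g'_i = γ∕2 + (γ∕2)θ′^i` lie in the window `]0, γ]` (`γ > 0`, `0 ≤ θ′ ≤ 1`) and their discrepancy is
EXACTLY the geometric profile `(γ∕2)·θ′^i`. [folklore] -/
theorem pair_mem_window {γ θ' : ℝ} (hγ : 0 < γ) (hθ'0 : 0 ≤ θ') (hθ'1 : θ' ≤ 1) :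
    (fun _ : ℕ => γ / 2) ∈ Window γ ∧ (fun i : ℕ => γ / 2 + γ / 2 * θ' ^ i) ∈ Window γ ∧
      ∀ i : ℕ, |(fun _ : ℕ => γ / 2) i - (fun i : ℕ => γ / 2 + γ / 2 * θ' ^ i) i| = γ / 2 * θ' ^ i := by
  have hp : ∀ i : ℕ, 0 ≤ θ' ^ i ∧ θ' ^ i ≤ 1 := fun i => ⟨pow_nonneg hθ'0 i, pow_le_one₀ hθ'0 hθ'1⟩
  refine ⟨fun i => ⟨by linarith, by linarith⟩, fun i => ⟨?_, ?_⟩, fun i => ?_⟩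
  · have := (hp i).1
    positivity
  · have := (hp i).2
    nlinarith
  · rw [show γ / 2 - (γ / 2 + γ / 2 * θ' ^ i) = -(γ / 2 * θ' ^ i) by ring, abs_neg,
      abs_of_nonneg (by have := (hp i).1; positivity)]

/-- **THE BRACKET IN CLOSED FORM**: at level `n + 2` the two terms differ by EXACTLY `(1 + |log((γ∕2)·θ′^n)|)⁻¹` (`γ > 0`, `θ′ > 0`). [folklore] -/
theorem abs_sub_slowTower_eq {γ θ' : ℝ} (hγ : 0 < γ) (hθ' : 0 < θ') (n : ℕ) :
    |slowTower γ (n + 2) (fun _ => γ / 2) - slowTower γ (n + 2) (fun i => γ / 2 + γ / 2 * θ' ^ i)| =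
      (1 + |Real.log (γ / 2 * θ' ^ n)|)⁻¹ := by
  have hne : γ / 2 * θ' ^ n ≠ 0 := by positivity
  rw [slowTower_of_le (by omega), slowTower_of_le (by omega), Nat.add_sub_cancel, sub_self, slowMod_zero,
    show γ / 2 + γ / 2 * θ' ^ n - γ / 2 = γ / 2 * θ' ^ n by ring, slowMod_of_ne_zero hne, zero_sub, abs_neg,
    abs_of_nonneg (by positivity)]

/-- **HARMONIC LOWER BOUND**: `(1 + |log((γ∕2)·θ′^n)|)⁻¹ ≥ κ·(n+1)⁻¹` with `κ = (1 + |log(γ∕2)| + |log θ′|)⁻¹`, since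
`|log((γ∕2)θ′^n)| ≤ |log(γ∕2)| + n·|log θ′|`. [folklore] -/
theorem bracket_lower {γ θ' : ℝ} (hγ : 0 < γ) (hθ' : 0 < θ') (n : ℕ) :
    (1 + |Real.log (γ / 2)| + |Real.log θ'|)⁻¹ * ((n : ℝ) + 1)⁻¹ ≤ (1 + |Real.log (γ / 2 * θ' ^ n)|)⁻¹ := by
  set A := |Real.log (γ / 2)|
  set B := |Real.log θ'|
  have hA : 0 ≤ A := abs_nonneg _
  have hB : 0 ≤ B := abs_nonneg _
  have hlog : |Real.log (γ / 2 * θ' ^ n)| ≤ A + n * B := by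
    rw [Real.log_mul (by positivity) (by positivity), Real.log_pow]
    calc |Real.log (γ / 2) + n * Real.log θ'| ≤ |Real.log (γ / 2)| + |(n : ℝ) * Real.log θ'| := abs_add_le _ _
      _ = A + n * B := by rw [abs_mul, Nat.abs_cast]
  have hle : 1 + |Real.log (γ / 2 * θ' ^ n)| ≤ (1 + A + B) * ((n : ℝ) + 1) := by
    have hn : (0 : ℝ) ≤ n := Nat.cast_nonneg n
    nlinarith
  rw [← mul_inv]
  exact inv_anti₀ (by positivity) hle

/-- **THE BRACKET IS NOT SUMMABLE** (`γ > 0`, `0 < θ′`): `Σ_m |F m g − F m g'| = ∞` for the admissible pair of `pair_mem_window` — harmonic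
comparison through `abs_sub_slowTower_eq` and `bracket_lower`. [folklore] -/
theorem not_summable_bracket {γ θ' : ℝ} (hγ : 0 < γ) (hθ' : 0 < θ') :
    ¬ Summable (fun m : ℕ =>
      |slowTower γ m (fun _ => γ / 2) - slowTower γ m (fun i => γ / 2 + γ / 2 * θ' ^ i)|) := by
  intro hs
  set κ := (1 + |Real.log (γ / 2)| + |Real.log θ'|)⁻¹ with hκ
  have hκ0 : 0 < κ := by positivity
  have hshift := (summable_nat_add_iff 2).mpr hs
  have hcmp : Summable (fun n : ℕ => κ * ((n : ℝ) + 1)⁻¹) := by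
    refine Summable.of_nonneg_of_le (fun n => by positivity) (fun n => ?_) hshift
    rw [abs_sub_slowTower_eq hγ hθ' n]
    exact bracket_lower hγ hθ' n
  have hharm : ¬ Summable (fun n : ℕ => ((n : ℝ) + 1)⁻¹) := by
    have h := mt (summable_nat_add_iff (f := fun n : ℕ => 1 / (n : ℝ)) 1).1 Real.not_summable_one_div_natCast
    simpa [one_div] using h
  exact hharm ((summable_mul_left_iff hκ0.ne').mp hcmp)

/-! ## §4 Node U6's socket fails for every injection dominating the bracket -/

/-- The transported total dominates its diagonal entry: `0 ≤ inj`, `0 ≤ E`, `0 ≤ ρ` ⇒ `E·inj K K ≤ T4CauchySum.delta E ρ inj K`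
(the term `(j, n) = (K, 0)` of the antidiagonal). [folklore] -/
theorem mul_diag_le_delta {E ρ : ℝ} {inj : ℕ → ℕ → ℝ} (hE : 0 ≤ E) (hρ : 0 ≤ ρ)
    (hinj : ∀ K j : ℕ, j ≤ K → 0 ≤ inj K j) (K : ℕ) : E * inj K K ≤ delta E ρ inj K := by
  unfold delta
  refine mul_le_mul_of_nonneg_left ?_ hE
  have hmem : (K, 0) ∈ antidiagonal K := by simp
  have h := single_le_sum (f := fun p : ℕ × ℕ => inj K p.1 * ρ ^ p.2)
    (fun p hp => mul_nonneg (hinj K p.1 (by have := mem_antidiagonal.mp hp; omega)) (pow_nonneg hρ _)) hmem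
  simpa using h

/-- **NODE U6 FAILS ON THE WITNESS**: for the slow tower and the admissible pair, NO injection `inj ≥ 0` dominating the coupling bracket on the
diagonal (`|F K g − F K g'| ≤ inj K K` — what node U3 feeds node U6 for runs `K`, `K + 1`) has `Summable (T4CauchySum.delta E ρ inj)` when
`E > 0`, `ρ ≥ 0`. [folklore] -/
theorem not_summable_delta {γ θ' : ℝ} (hγ : 0 < γ) (hθ' : 0 < θ') {E ρ : ℝ} (hE : 0 < E) (hρ : 0 ≤ ρ)
    {inj : ℕ → ℕ → ℝ} (hinj : ∀ K j : ℕ, j ≤ K → 0 ≤ inj K j)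
    (hdom : ∀ K : ℕ, |slowTower γ K (fun _ => γ / 2) - slowTower γ K (fun i => γ / 2 + γ / 2 * θ' ^ i)| ≤ inj K K) :
    ¬ Summable (delta E ρ inj) := by
  intro hs
  have hcmp : Summable (fun K : ℕ =>
      E * |slowTower γ K (fun _ => γ / 2) - slowTower γ K (fun i => γ / 2 + γ / 2 * θ' ^ i)|) := by
    refine Summable.of_nonneg_of_le (fun K => by positivity) (fun K => ?_) hs
    exact (mul_le_mul_of_nonneg_left (hdom K) hE.le).trans (mul_diag_le_delta hE.le hρ hinj K)
  exact not_summable_bracket hγ hθ' ((summable_mul_left_iff hE.ne').mp hcmp)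

/-- **PACKAGED: CONTINUITY IS NOT ENOUGH.**  For every window `]0, γ]` (`γ > 0`) and every geometric ratio `0 < θ′ ≤ 1` of node U2 there is a
tower `F` (namely `slowTower γ`) with: every `F m` CONTINUOUS; age-two dependence only (prefix dependence, NO dependence on the last
coupling); `0 ≤ F ≤ 1`; the tower rate `θ⁻¹θ^m` for every `0 < θ` and every history — and two admissible histories with discrepancy EXACTLY
`(γ∕2)·θ′^i` whose coupling bracket is not summable, so that node U6's `Summable (T4CauchySum.delta E ρ inj)` fails for every nonnegative
injection dominating it (`E > 0`, `ρ ≥ 0`).  Compare `MemoryFromRateModulus.summable_delta_of_holder_bounded`: a Hölder modulus in the young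
couplings suffices; no modulus does not. [folklore] -/
theorem exists_continuousTower_not_summable {γ θ' : ℝ} (hγ : 0 < γ) (hθ'0 : 0 < θ') (hθ'1 : θ' ≤ 1) :
    ∃ F : ℕ → (ℕ → ℝ) → ℝ,
      (∀ m, Continuous (F m)) ∧
      (∀ m (g g' : ℕ → ℝ), g (m - 2) = g' (m - 2) → F m g = F m g') ∧
      (∀ m g, 0 ≤ F m g ∧ F m g ≤ 1) ∧
      (∀ θ : ℝ, 0 < θ → ∀ m g, |F (m + 1) g - F m (fun i => g (i + 1))| ≤ θ⁻¹ * θ ^ m) ∧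
      ∃ g ∈ Window γ, ∃ g' ∈ Window γ,
        (∀ i, |g i - g' i| = γ / 2 * θ' ^ i) ∧
        ¬ Summable (fun m => |F m g - F m g'|) ∧
        ∀ (E ρ : ℝ) (inj : ℕ → ℕ → ℝ), 0 < E → 0 ≤ ρ → (∀ K j : ℕ, j ≤ K → 0 ≤ inj K j) →
          (∀ K, |F K g - F K g'| ≤ inj K K) → ¬ Summable (delta E ρ inj) := by
  obtain ⟨hg, hg', hd⟩ := pair_mem_window hγ hθ'0.le hθ'1
  exact ⟨slowTower γ, continuous_slowTower γ, fun m g g' h => slowTower_congr γ m h, slowTower_mem_Icc γ,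
    fun θ hθ m g => slowTower_rate γ hθ m g, _, hg, _, hg', hd, not_summable_bracket hγ hθ'0,
    fun E ρ inj hE hρ hinj hdom => not_summable_delta hγ hθ'0 hE hρ hinj hdom⟩

end Summit.QuantumFields.BalabanUV.T4Continuum.NE9.MemoryFromRateSharp
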